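import Mathlib

/-!
# Conjecture N (hodge-weil ladder, GAPS G51b), format (5,3): THE GAUGE VALUE OF `G` FOR AN ARBITRARY CONFIGURATION

Prover 2, generation 23 (note `run/shared/lean/b2b/hodge-weil/b2b-hweil-pv2-g23/CROSSPLUS2-G23.md`). Generations 21/22 evaluated `G = Q₂ + Q₄`
on a cross (`G_on_cross_53`) and on a cross with ONE free root (`G_gauge_cross_plus_one`, `…_F`). The same linear combination of the vertex-gauge
identities works with EVERY root off the cross: **`G_gauge_general`** gives `G` for an arbitrary centred configuration with `P2 = P4 = 0` in terms of
`S, Mo, T, us` and the eight defects `e_k, f_g` — the configuration-level input of the reduced system for 'cross + k free roots' for every `k`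
(set the defects of the on-cross roots to `0`), cf. `WeilClassTestFormatFiveThreePurityLineForm`. Pure algebra (`linear_combination`); nothing here
is a case of HC, a rung or a door edge; no statement of Markman's papers is used; COUNT of record unchanged. New cell result ⇒ Summits/.
-/

set_option linter.dupNamespace false
set_option maxRecDepth 16384

namespace Summit.HodgeConjecture.HodgeConjecture.WeilClassTestFormatFiveThreeGeneralGauge

set_option maxHeartbeats 4000000 in
/-- **`G = Q₂ + Q₄` FOR AN ARBITRARY centred format-(5,3) configuration with `P2 = P4 = 0`, relative to ANY base point `(As, us)`.**
Every root carries a DEFECT: `(A_k − As)² = (u_k − us)² + 4e_k` for the E-roots, `(As − B_g)² = (v_g − us)² + 4f_g` for the F-roots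
(in corner coordinates `e_k = x_k·y_k`, `f_g = p_g·q_g`; a root lies on the cross through the base point iff its defect is `0`). Then
`Q₂ + Q₄ = Mo² + (S/2)·T² − S² − 2·S·us² − Σ_k 4e_k·(3(u_k² − S/2) + S) + Σ_g 4f_g·(3(v_g² − S/2) + S)`
(`S = Σεu²`, `Mo = Σ_k u_k(A_k − As) + Σ_g v_g(As − B_g)`, `T = Σ_k (A_k − As) + Σ_g (As − B_g)`). Generation 22's `G_gauge_cross_plus_one(_F)`
are the cases with one nonzero defect; the linear combination of the gauge identities is the same for every root. (P1 is not used.) -/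
theorem G_gauge_general (A₁ A₂ A₃ A₄ A₅ B₁ B₂ B₃ u₁ u₂ u₃ u₄ u₅ v₁ v₂ v₃ As us e₁ e₂ e₃ e₄ e₅ f₁ f₂ f₃ : ℝ)
    (hA : A₁ + A₂ + A₃ + A₄ + A₅ = B₁ + B₂ + B₃) (hC : u₁ + u₂ + u₃ + u₄ + u₅ = v₁ + v₂ + v₃)
    (hP2 : ((A₁ * u₁ ^ 2 + A₂ * u₂ ^ 2 + A₃ * u₃ ^ 2 + A₄ * u₄ ^ 2 + A₅ * u₅ ^ 2) - (B₁ * v₁ ^ 2 + B₂ * v₂ ^ 2 + B₃ * v₃ ^ 2)) = 0)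
    (hP4 : ((u₁ ^ 3 + u₂ ^ 3 + u₃ ^ 3 + u₄ ^ 3 + u₅ ^ 3) - (v₁ ^ 3 + v₂ ^ 3 + v₃ ^ 3)) = 0)
    (hX₁ : (A₁ - As) ^ 2 = (u₁ - us) ^ 2 + 4 * e₁) (hX₂ : (A₂ - As) ^ 2 = (u₂ - us) ^ 2 + 4 * e₂) (hX₃ : (A₃ - As) ^ 2 = (u₃ - us) ^ 2 + 4 * e₃) (hX₄ : (A₄ - As) ^ 2 = (u₄ - us) ^ 2 + 4 * e₄) (hX₅ : (A₅ - As) ^ 2 = (u₅ - us) ^ 2 + 4 * e₅) (hY₁ : (As - B₁) ^ 2 = (v₁ - us) ^ 2 + 4 * f₁) (hY₂ : (As - B₂) ^ 2 = (v₂ - us) ^ 2 + 4 * f₂) (hY₃ : (As - B₃) ^ 2 = (v₃ - us) ^ 2 + 4 * f₃) :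
    (1 / 2) * ((A₁ ^ 2 + A₂ ^ 2 + A₃ ^ 2 + A₄ ^ 2 + A₅ ^ 2) - (B₁ ^ 2 + B₂ ^ 2 + B₃ ^ 2)) * ((u₁ ^ 2 + u₂ ^ 2 + u₃ ^ 2 + u₄ ^ 2 + u₅ ^ 2) - (v₁ ^ 2 + v₂ ^ 2 + v₃ ^ 2))
        + ((A₁ * u₁ + A₂ * u₂ + A₃ * u₃ + A₄ * u₄ + A₅ * u₅) - (B₁ * v₁ + B₂ * v₂ + B₃ * v₃)) ^ 2
        - 3 * ((A₁ ^ 2 * u₁ ^ 2 + A₂ ^ 2 * u₂ ^ 2 + A₃ ^ 2 * u₃ ^ 2 + A₄ ^ 2 * u₄ ^ 2 + A₅ ^ 2 * u₅ ^ 2) - (B₁ ^ 2 * v₁ ^ 2 + B₂ ^ 2 * v₂ ^ 2 + B₃ ^ 2 * v₃ ^ 2))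
      + (3 * ((u₁ ^ 4 + u₂ ^ 4 + u₃ ^ 4 + u₄ ^ 4 + u₅ ^ 4) - (v₁ ^ 4 + v₂ ^ 4 + v₃ ^ 4)) - (3 / 2) * ((u₁ ^ 2 + u₂ ^ 2 + u₃ ^ 2 + u₄ ^ 2 + u₅ ^ 2) - (v₁ ^ 2 + v₂ ^ 2 + v₃ ^ 2)) ^ 2)
      = (u₁ * (A₁ - As) + u₂ * (A₂ - As) + u₃ * (A₃ - As) + u₄ * (A₄ - As) + u₅ * (A₅ - As) + v₁ * (As - B₁) + v₂ * (As - B₂) + v₃ * (As - B₃)) ^ 2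
        + (((u₁ ^ 2 + u₂ ^ 2 + u₃ ^ 2 + u₄ ^ 2 + u₅ ^ 2) - (v₁ ^ 2 + v₂ ^ 2 + v₃ ^ 2)) / 2) * ((A₁ - As) + (A₂ - As) + (A₃ - As) + (A₄ - As) + (A₅ - As) + (As - B₁) + (As - B₂) + (As - B₃)) ^ 2
        - ((u₁ ^ 2 + u₂ ^ 2 + u₃ ^ 2 + u₄ ^ 2 + u₅ ^ 2) - (v₁ ^ 2 + v₂ ^ 2 + v₃ ^ 2)) ^ 2 - 2 * ((u₁ ^ 2 + u₂ ^ 2 + u₃ ^ 2 + u₄ ^ 2 + u₅ ^ 2) - (v₁ ^ 2 + v₂ ^ 2 + v₃ ^ 2)) * us ^ 2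
        - 4 * e₁ * (3 * (u₁ ^ 2 - ((u₁ ^ 2 + u₂ ^ 2 + u₃ ^ 2 + u₄ ^ 2 + u₅ ^ 2) - (v₁ ^ 2 + v₂ ^ 2 + v₃ ^ 2)) / 2) + ((u₁ ^ 2 + u₂ ^ 2 + u₃ ^ 2 + u₄ ^ 2 + u₅ ^ 2) - (v₁ ^ 2 + v₂ ^ 2 + v₃ ^ 2))) - 4 * e₂ * (3 * (u₂ ^ 2 - ((u₁ ^ 2 + u₂ ^ 2 + u₃ ^ 2 + u₄ ^ 2 + u₅ ^ 2) - (v₁ ^ 2 + v₂ ^ 2 + v₃ ^ 2)) / 2) + ((u₁ ^ 2 + u₂ ^ 2 + u₃ ^ 2 + u₄ ^ 2 + u₅ ^ 2) - (v₁ ^ 2 + v₂ ^ 2 + v₃ ^ 2))) - 4 * e₃ * (3 * (u₃ ^ 2 - ((u₁ ^ 2 + u₂ ^ 2 + u₃ ^ 2 + u₄ ^ 2 + u₅ ^ 2) - (v₁ ^ 2 + v₂ ^ 2 + v₃ ^ 2)) / 2) + ((u₁ ^ 2 + u₂ ^ 2 + u₃ ^ 2 + u₄ ^ 2 + u₅ ^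 2) - (v₁ ^ 2 + v₂ ^ 2 + v₃ ^ 2))) - 4 * e₄ * (3 * (u₄ ^ 2 - ((u₁ ^ 2 + u₂ ^ 2 + u₃ ^ 2 + u₄ ^ 2 + u₅ ^ 2) - (v₁ ^ 2 + v₂ ^ 2 + v₃ ^ 2)) / 2) + ((u₁ ^ 2 + u₂ ^ 2 + u₃ ^ 2 + u₄ ^ 2 + u₅ ^ 2) - (v₁ ^ 2 + v₂ ^ 2 + v₃ ^ 2))) - 4 * e₅ * (3 * (u₅ ^ 2 - ((u₁ ^ 2 + u₂ ^ 2 + u₃ ^ 2 + u₄ ^ 2 + u₅ ^ 2) - (v₁ ^ 2 + v₂ ^ 2 + v₃ ^ 2)) / 2) + ((u₁ ^ 2 + u₂ ^ 2 + u₃ ^ 2 + u₄ ^ 2 + u₅ ^ 2) - (v₁ ^ 2 + v₂ ^ 2 + v₃ ^ 2)))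
        + 4 * f₁ * (3 * (v₁ ^ 2 - ((u₁ ^ 2 + u₂ ^ 2 + u₃ ^ 2 + u₄ ^ 2 + u₅ ^ 2) - (v₁ ^ 2 + v₂ ^ 2 + v₃ ^ 2)) / 2) + ((u₁ ^ 2 + u₂ ^ 2 + u₃ ^ 2 + u₄ ^ 2 + u₅ ^ 2) - (v₁ ^ 2 + v₂ ^ 2 + v₃ ^ 2))) + 4 * f₂ * (3 * (v₂ ^ 2 - ((u₁ ^ 2 + u₂ ^ 2 + u₃ ^ 2 + u₄ ^ 2 + u₅ ^ 2) - (v₁ ^ 2 + v₂ ^ 2 + v₃ ^ 2)) / 2) + ((u₁ ^ 2 + u₂ ^ 2 + u₃ ^ 2 + u₄ ^ 2 + u₅ ^ 2) - (v₁ ^ 2 + v₂ ^ 2 + v₃ ^ 2))) + 4 * f₃ * (3 * (v₃ ^ 2 - ((u₁ ^ 2 + u₂ ^ 2 + u₃ ^ 2 + u₄ ^ 2 + u₅ ^ 2) - (v₁ ^ 2 + v₂ ^ 2 + v₃ ^ 2)) / 2) + ((u₁ ^ 2 + u₂ ^ 2 + u₃ ^ 2 + u₄ ^ 2 + u₅ ^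 2) - (v₁ ^ 2 + v₂ ^ 2 + v₃ ^ 2))) := by
  linear_combination ((((u₁ ^ 2 + u₂ ^ 2 + u₃ ^ 2 + u₄ ^ 2 + u₅ ^ 2) - (v₁ ^ 2 + v₂ ^ 2 + v₃ ^ 2)) * ((A₁ + A₂ + A₃ + A₄ + A₅) - (B₁ + B₂ + B₃)) - 3 * ((A₁ * u₁ ^ 2 + A₂ * u₂ ^ 2 + A₃ * u₃ ^ 2 + A₄ * u₄ ^ 2 + A₅ * u₅ ^ 2) - (B₁ * v₁ ^ 2 + B₂ * v₂ ^ 2 + B₃ * v₃ ^ 2))) - 3 * ((A₁ - As) + (A₂ - As) + (A₃ - As) + (A₄ - As) + (A₅ - As) + (As - B₁) + (As - B₂) + (As - B₃)) * (((u₁ ^ 2 + u₂ ^ 2 + u₃ ^ 2 + u₄ ^ 2 + u₅ ^ 2) - (v₁ ^ 2 + v₂ ^ 2 + v₃ ^ 2)) / 2)) * hA + ((2 * As * ((A₁ * u₁ + A₂ * u₂ + A₃ * u₃ + A₄ * u₄ + A₅ * u₅) - (B₁ * v₁ + B₂ * v₂ + B₃ * v₃)) - As ^ 2 * ((u₁ +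 u₂ + u₃ + u₄ + u₅) - (v₁ + v₂ + v₃))) - (us * ((u₁ ^ 2 + u₂ ^ 2 + u₃ ^ 2 + u₄ ^ 2 + u₅ ^ 2) - (v₁ ^ 2 + v₂ ^ 2 + v₃ ^ 2)))) * hC + (3 * ((A₁ - As) + (A₂ - As) + (A₃ - As) + (A₄ - As) + (A₅ - As) + (As - B₁) + (As - B₂) + (As - B₃))) * hP2 + (6 * us) * hP4 + (-(3 * (u₁ ^ 2 - ((u₁ ^ 2 + u₂ ^ 2 + u₃ ^ 2 + u₄ ^ 2 + u₅ ^ 2) - (v₁ ^ 2 + v₂ ^ 2 + v₃ ^ 2)) / 2) + ((u₁ ^ 2 + u₂ ^ 2 + u₃ ^ 2 + u₄ ^ 2 + u₅ ^ 2) - (v₁ ^ 2 + v₂ ^ 2 + v₃ ^ 2)))) * hX₁ + (-(3 * (u₂ ^ 2 - ((u₁ ^ 2 + u₂ ^ 2 + u₃ ^ 2 + u₄ ^ 2 + u₅ ^ 2) - (v₁ ^ 2 + v₂ ^ 2 + v₃ ^ 2)) / 2) + ((u₁ ^ 2 + u₂ ^ 2 + u₃ ^ 2 + u₄ ^ 2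 + u₅ ^ 2) - (v₁ ^ 2 + v₂ ^ 2 + v₃ ^ 2)))) * hX₂ + (-(3 * (u₃ ^ 2 - ((u₁ ^ 2 + u₂ ^ 2 + u₃ ^ 2 + u₄ ^ 2 + u₅ ^ 2) - (v₁ ^ 2 + v₂ ^ 2 + v₃ ^ 2)) / 2) + ((u₁ ^ 2 + u₂ ^ 2 + u₃ ^ 2 + u₄ ^ 2 + u₅ ^ 2) - (v₁ ^ 2 + v₂ ^ 2 + v₃ ^ 2)))) * hX₃ + (-(3 * (u₄ ^ 2 - ((u₁ ^ 2 + u₂ ^ 2 + u₃ ^ 2 + u₄ ^ 2 + u₅ ^ 2) - (v₁ ^ 2 + v₂ ^ 2 + v₃ ^ 2)) / 2) + ((u₁ ^ 2 + u₂ ^ 2 + u₃ ^ 2 + u₄ ^ 2 + u₅ ^ 2) - (v₁ ^ 2 + v₂ ^ 2 + v₃ ^ 2)))) * hX₄ + (-(3 * (u₅ ^ 2 - ((u₁ ^ 2 + u₂ ^ 2 + u₃ ^ 2 + u₄ ^ 2 + u₅ ^ 2) - (v₁ ^ 2 + v₂ ^ 2 + v₃ ^ 2)) / 2) + ((u₁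 ^ 2 + u₂ ^ 2 + u₃ ^ 2 + u₄ ^ 2 + u₅ ^ 2) - (v₁ ^ 2 + v₂ ^ 2 + v₃ ^ 2)))) * hX₅ + (3 * (v₁ ^ 2 - ((u₁ ^ 2 + u₂ ^ 2 + u₃ ^ 2 + u₄ ^ 2 + u₅ ^ 2) - (v₁ ^ 2 + v₂ ^ 2 + v₃ ^ 2)) / 2) + ((u₁ ^ 2 + u₂ ^ 2 + u₃ ^ 2 + u₄ ^ 2 + u₅ ^ 2) - (v₁ ^ 2 + v₂ ^ 2 + v₃ ^ 2))) * hY₁ + (3 * (v₂ ^ 2 - ((u₁ ^ 2 + u₂ ^ 2 + u₃ ^ 2 + u₄ ^ 2 + u₅ ^ 2) - (v₁ ^ 2 + v₂ ^ 2 + v₃ ^ 2)) / 2) + ((u₁ ^ 2 + u₂ ^ 2 + u₃ ^ 2 + u₄ ^ 2 + u₅ ^ 2) - (v₁ ^ 2 + v₂ ^ 2 + v₃ ^ 2))) * hY₂ + (3 * (v₃ ^ 2 - ((u₁ ^ 2 + u₂ ^ 2 + u₃ ^ 2 + u₄ ^ 2 + u₅ ^ 2) - (v₁ ^ 2 + v₂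 ^ 2 + v₃ ^ 2)) / 2) + ((u₁ ^ 2 + u₂ ^ 2 + u₃ ^ 2 + u₄ ^ 2 + u₅ ^ 2) - (v₁ ^ 2 + v₂ ^ 2 + v₃ ^ 2))) * hY₃

end Summit.HodgeConjecture.HodgeConjecture.WeilClassTestFormatFiveThreeGeneralGauge
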